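import Literature.Topology.FourManifolds.HCobordismAuxiliaryPairIsotopy
import Literature.Topology.FourManifolds.HCobordismAdjustField
import HarnessLib

/-!
# Milnor 1965, proof of Thm. 8.1 (Index 1), PDF pp. 55–56: the auxiliary pair from the named
# facts that remain open, Lemma 4.7 and Thm. 5.8 discharged

Topic `Literature/Topology/FourManifolds` (fact seat
`provefact-Literature.Topology.FourManifolds.Cobordism.Milnor1965_exists_auxiliaryPair`).  Bookkeeping for the parent fact
`Literature.Topology.FourManifolds.Cobordism.Milnor1965_exists_auxiliaryPair` (`HCobordismTradeStep.lean`): of the six printed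
ingredients of Milnor's construction on PDF pp. 55–56 isolated in `HCobordismAuxiliaryPair.lean`,

* Lemma 4.7 to the right of the level (`Literature.Topology.FourManifolds.Cobordism.Milnor1965_adjust_field_right`) is now the
  theorem `Literature.Topology.FourManifolds.Cobordism.Milnor1965_adjust_field_right_holds` (`HCobordismAdjustField.lean`);
* Thm. 5.8 (isotopy extension) is the theorem
  `Literature.Topology.FourManifolds.isAmbientIsotopic_of_isSmoothlyIsotopic_euclidean` (`IsotopyExtension.lean`), consumed by
  `Literature.Topology.FourManifolds.Cobordism.Milnor1965_exists_auxiliaryPair_of_facts'` (`HCobordismAuxiliaryPairIsotopy.lean`);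
* the perturbation of Lemma 8.2 / pp. 55–56 (`…insert_pair_gradientLike`) was proved in
  `HCobordismAuxiliaryPair.lean`.

Hence the parent fact follows from the four named facts that remain: Lemma 8.3 with the
translation to `V₂₊` (`Literature.Topology.FourManifolds.Cobordism.Milnor1965_exists_idealCircle`), Def. 3.9 — the left-hand
sphere is an embedded sphere (`Literature.Topology.FourManifolds.Cobordism.Milnor1965_leftHandSphere_embedded`), `π₁(V₂₊) = 1`
(`Literature.Topology.FourManifolds.Cobordism.Milnor1965_simplyConnected_plusLevelTwo`), and Thm. 8.4 in the range of its Remark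
(`Literature.Topology.FourManifolds.Milnor1965_isSmoothlyIsotopic_of_homotopic_of_two_mul_add_two_le`, Whitney 1936).  This file
records that reduction as `Cobordism.Milnor1965_exists_auxiliaryPair_of_facts''`, and — the embedded
left-hand sphere having since been proved (`Cobordism.Milnor1965_leftHandSphere_embedded_holds`,
`HCobordismAuxiliaryPairProofs.lean`, from `LeftHandSphereEmbedding.lean`) — the reduction to the
three facts that remain as `Cobordism.Milnor1965_exists_auxiliaryPair_of_facts'''`; everything here
is proved.

## References

* J. Milnor, *Lectures on the h-cobordism theorem*, notes by L. Siebenmann and J. Sondow,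
  Princeton Mathematical Notes (1965): proof of Thm. 8.1, Index 1 (PDF pp. 55–56), Lemmas 8.2,
  8.3, Thm. 8.4 and Remark, Lemma 4.7, Thm. 5.8.  Held:
  `lit read book:milnornd-lectures-h-cobordism-theorem`. [MilnorHCobordism1965]
-/

noncomputable section

namespace Literature.Topology.FourManifolds

universe u

/-- **The auxiliary pair (PDF pp. 55–56) from the four named facts that remain open**, with
Lemma 4.7 (`Cobordism.Milnor1965_adjust_field_right_holds`) and Thm. 5.8
(`isAmbientIsotopic_of_isSmoothlyIsotopic_euclidean`) discharged: the named fact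
`Literature.Topology.FourManifolds.Cobordism.Milnor1965_exists_auxiliaryPair` follows from Lemma 8.3 with the translation to `V₂₊`,
the embedded left-hand sphere, `π₁(V₂₊) = 1`, and Thm. 8.4 in the range of its Remark.
[cite: MilnorHCobordism1965, proof of Thm. 8.1 Index 1 (PDF pp. 55–56), with Lemmas 8.2, 8.3, 4.7, Thm. 8.4 and Remark, Thm. 5.8] -/
theorem Cobordism.Milnor1965_exists_auxiliaryPair_of_facts''
    (hA : Cobordism.Milnor1965_exists_idealCircle.{u})
    (hC : Cobordism.Milnor1965_leftHandSphere_embedded.{u})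
    (hD : Cobordism.Milnor1965_simplyConnected_plusLevelTwo.{u})
    (h84 : Milnor1965_isSmoothlyIsotopic_of_homotopic_of_two_mul_add_two_le.{0, u}) :
    Cobordism.Milnor1965_exists_auxiliaryPair.{u} :=
  Cobordism.Milnor1965_exists_auxiliaryPair_of_facts' hA hC hD
    Cobordism.Milnor1965_adjust_field_right_holds h84

/-- **The auxiliary pair (PDF pp. 55–56) from the three named facts that remain open**, with,
in addition, Def. 3.9 / §4 — *the left-hand sphere in a lower level is an embedded sphere* —
discharged (`Cobordism.Milnor1965_leftHandSphere_embedded_holds`, `HCobordismAuxiliaryPairProofs.lean`,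
from `LeftHandSphereEmbedding.lean`): the named fact
`Literature.Topology.FourManifolds.Cobordism.Milnor1965_exists_auxiliaryPair` follows from Lemma 8.3 with the translation to `V₂₊`
(`…exists_idealCircle`), `π₁(V₂₊) = 1` (`…simplyConnected_plusLevelTwo`) and Thm. 8.4 in the
range of its Remark (`…of_two_mul_add_two_le`).
[cite: MilnorHCobordism1965, proof of Thm. 8.1 Index 1 (PDF pp. 55–56), with Lemmas 8.2, 8.3, 4.7, Def. 3.9, Thm. 8.4 and Remark, Thm. 5.8] -/
theorem Cobordism.Milnor1965_exists_auxiliaryPair_of_facts'''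
    (hA : Cobordism.Milnor1965_exists_idealCircle.{u})
    (hD : Cobordism.Milnor1965_simplyConnected_plusLevelTwo.{u})
    (h84 : Milnor1965_isSmoothlyIsotopic_of_homotopic_of_two_mul_add_two_le.{0, u}) :
    Cobordism.Milnor1965_exists_auxiliaryPair.{u} :=
  Cobordism.Milnor1965_exists_auxiliaryPair_of_facts'' hA
    Cobordism.Milnor1965_leftHandSphere_embedded_holds hD h84

end Literature.Topology.FourManifolds
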